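import Summits.HubbardSuperconductivity.HubbardSuperconductivity.Theses.LogColdTorus
import Summits.HubbardSuperconductivity.HubbardSuperconductivity.Theorems.LogColdTorusAverageToEveryTransfer
import Summits.HubbardSuperconductivity.HubbardSuperconductivity.Theorems.BalabanIRBirEveryGroundStateSourceShift
import Summits.HubbardSuperconductivity.HubbardSuperconductivity.Theorems.BalabanIRBirGroundStateAverageLROSoftminSocketEquiv
import Literature.MathematicalPhysics.QuantumLattice.SectorGroundProjContinuity
import HarnessLib

/-!
# Route `LogColdTorus`, crux `AverageToEvery` (item `stmt-HubbardSuperconductivity-10519`, shared with route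
`AbelianDuality`): the conjugate-source RE-CUT of this route, kernel-certified

Helpers (`--supports`) for the crux
`Summit.HubbardSuperconductivity.HubbardSuperconductivity.Theses.LogColdTorus.AverageToEvery`.
Plan-level facts (D-0014: the lead reports on the plan with evidence). The crux's open content is the
doped every-ground-state law (`averageToEvery_iff_dopedTransfer`, lead c16), source-less and
insulated (three `promote-stub` verdicts; sibling census `Cruxes/BirEveryGroundState/STRATEGY-CENSUS.md`).
The census's "door" for the sibling route is a ROUTE-LEVEL re-cut through the conjugate source
`κ L⁻⁴ Δ_d† Δ_d` over the landed closer `hubbardSuperconductivity_of_shiftedAverage`. This file ports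
that door to `LogColdTorus` and certifies both directions:

* `exists_penalisedAverage_of_forall_groundState_bound` /
  `exists_shiftedAverage_of_forall_groundState_bound` — **zero-temperature converse of the closer,
  per side**: an every-ground-state floor `a L⁴` on the sector ground eigenspace of
  `hubbardTorus 2 L 1 U` gives, for some `κ > 0`, the ground-state-AVERAGE bound `(a/4) L⁴` for the
  PENALISED Hamiltonian `H + κ L⁻⁴ Δ_d† Δ_d` in the closer's own matrix (first-order splitting in
  variational form, `re_quadForm_ge_of_penalisedGroundState`, summed over an orthonormal frame). So
  per side the shifted average and the every-ground-state floor are one datum up to the constant `4`.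
* `hubbardSuperconductivity_of_logColdOrder_of_shiftedDescent` — **the route's deciding implication
  with cruxes #3 `LogColdToGround` (stmt-8808) and #4 `AverageToEvery` (stmt-10519) replaced by ONE
  "shifted descent" crux**: hypothesis verbatim that of `LogColdToGround`, conclusion the shifted
  ground-state average at one coupling of the window; `LogColdDWaveOrder → ShiftedDescent →
  HubbardSuperconductivity` over the landed closer. No genericity in `U`; the window is idle.
* `shiftedDescent_of_logColdToGround_of_averageToEvery` — **the merged crux is implied by the two it
  replaces** (`LogColdToGround → AverageToEvery → ShiftedDescent`), so the re-cut loses nothing.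

Sources: R. B. Griffiths, J. Math. Phys. 5 (1964) 1215 §III; T. Kato, *Perturbation Theory for
Linear Operators* (1966) §II.5; H. Tasaki (2020) §2.2, App. A.2; Scalapino, Phys. Rep. 250 (1995)
329 §2. Folklore bookkeeping over landed theorems; no definition and no named fact is introduced.

## Mathlib / tree search

REUSED: `Theorems.hubbardSuperconductivity_of_shiftedAverage` (`…SourceShift`),
`Theorems.averageToEvery_iff_transfer` (`…Transfer`), `Softmin.re_quadForm_ge_of_penalisedGroundState` /
`exists_gap_above` / `mul_re_le_re_quadForm_of_unit_bound` (`…SoftminPenalisedGroundStates`),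
`Theorems.re_expect_pairField_conjTranspose_mul_le`, `map_toEuclidean_eq` (`…Bounds`),
`hubbardTorus_mulVec_mem_szSector`, `isGroundStateInSector_of_mem_inf_eigenspace`,
`Literature…exists_frame_trace_projMatrix_map_mul`, `re_trace_projMatrix_map_eq_finrank`,
`exists_unit_eigen_minEnergyOn`, `minEnergyOn_le_rayleigh_of_mem`. `lean search
"shiftedAverage_of|of_forall_ground.*shifted"`: only the forward closer existed.
-/

noncomputable section

-- `dupNamespace`: the summit and the problem are both named `HubbardSuperconductivity` (layout D-0022)
set_option linter.dupNamespace false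

namespace Summit.HubbardSuperconductivity.HubbardSuperconductivity.Theorems

open Matrix Finset Filter
open Literature.Probability.LatticeModels Literature.MathematicalPhysics.QuantumLattice
open Summit.HubbardSuperconductivity.HubbardSuperconductivity.Theorems.BirGroundStateAverageLRO.Softmin
  (exists_gap_above re_quadForm_ge_of_penalisedGroundState mul_re_le_re_quadForm_of_unit_bound)
open scoped ComplexOrder Matrix Classical

/-! ## Zero temperature: an every-ground-state floor gives the SHIFTED ground-state average -/

/-- **Every-ground-state pair order ⇒ ground-state-AVERAGE pair order of the PENALISED torus, at a
small coupling.** On the `L × L` Hubbard torus (`H = hubbardTorus 2 L 1 U`, sector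
`S = (2m, S^z = 0)`, `m ≤ L²`, `A = Δ_d† Δ_d`): if every normalised sector ground state `ψ` of `H`
has `a L⁴ ≤ re ⟨ψ, A ψ⟩` (`a > 0`), then for some `g > 0` the projection `P_g` onto the sector
ground eigenspace of the penalised Hamiltonian `H + g A` satisfies
`(a/4) L⁴ · re tr P_g ≤ re tr (P_g A)`. Proof: every unit vector of that eigenspace is a trial
state for `H` and is variationally `(H + gA)`-minimal, so by the first-order splitting lemma
`re_quadForm_ge_of_penalisedGroundState` (gap `γ` of `H` above the sector energy from
`exists_gap_above`, norm ceiling `M = (C_d L²)² + 1` from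
`re_expect_pairField_conjTranspose_mul_le`, `2gM(aL⁴ + 2M) = γ aL⁴`) it carries `≥ (a/4) L⁴` of
`A`; sum over an orthonormal frame of the eigenspace (`exists_frame_trace_projMatrix_map_mul`).
This is the converse, at `T = 0` and per side, of the conjugate-source closer
`forall_ground_le_re_rayleigh_of_penalised_trace_le`. Kato (1966) §II.5 (variational form);
Griffiths, J. Math. Phys. 5 (1964) 1215 §III; Tasaki (2020) §2.2, App. A.2. [folklore] -/
theorem exists_penalisedAverage_of_forall_groundState_bound (L : ℕ) [NeZero L] (U a : ℝ) {m : ℕ}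
    (ha : 0 < a)
    (hGS : ∀ ψ : Fock (Orb (FermionTorus 2 L)),
      IsGroundStateInSector (hubbardTorus 2 L 1 U) (2 * m) 0 ψ → star ψ ⬝ᵥ ψ = 1 →
      a * (L : ℝ) ^ 4 ≤
        (star ψ ⬝ᵥ ((pairField dWaveFormFactor L)ᴴ * pairField dWaveFormFactor L) *ᵥ ψ).re) :
    ∃ g : ℝ, 0 < g ∧
      a / 4 * (L : ℝ) ^ 4 *
        (projMatrix ((szSector (Λ := FermionTorus 2 L) (2 * m) 0 ⊓
          Module.End.eigenspace (Matrix.toLin' (hubbardTorus 2 L 1 U +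
            ((g : ℝ) : ℂ) • ((pairField dWaveFormFactor L)ᴴ * pairField dWaveFormFactor L)))
            ((((hubbardTorus 2 L 1 U +
              ((g : ℝ) : ℂ) • ((pairField dWaveFormFactor L)ᴴ * pairField dWaveFormFactor L)).minEnergyOn
                (szSector (Λ := FermionTorus 2 L) (2 * m) 0) : ℝ)) : ℂ)).map
          ((WithLp.linearEquiv 2 ℂ (Finset (Orb (FermionTorus 2 L)) → ℂ)).symm :
            (Finset (Orb (FermionTorus 2 L)) → ℂ) →ₗ[ℂ]
              EuclideanSpace ℂ (Finset (Orb (FermionTorus 2 L)))))).trace.re ≤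
        (projMatrix ((szSector (Λ := FermionTorus 2 L) (2 * m) 0 ⊓
          Module.End.eigenspace (Matrix.toLin' (hubbardTorus 2 L 1 U +
            ((g : ℝ) : ℂ) • ((pairField dWaveFormFactor L)ᴴ * pairField dWaveFormFactor L)))
            ((((hubbardTorus 2 L 1 U +
              ((g : ℝ) : ℂ) • ((pairField dWaveFormFactor L)ᴴ * pairField dWaveFormFactor L)).minEnergyOn
                (szSector (Λ := FermionTorus 2 L) (2 * m) 0) : ℝ)) : ℂ)).map
          ((WithLp.linearEquiv 2 ℂ (Finset (Orb (FermionTorus 2 L)) → ℂ)).symm :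
            (Finset (Orb (FermionTorus 2 L)) → ℂ) →ₗ[ℂ]
              EuclideanSpace ℂ (Finset (Orb (FermionTorus 2 L))))) *
          ((pairField dWaveFormFactor L)ᴴ * pairField dWaveFormFactor L)).trace.re := by
  set A : Matrix (Finset (Orb (FermionTorus 2 L))) (Finset (Orb (FermionTorus 2 L))) ℂ :=
    (pairField dWaveFormFactor L)ᴴ * pairField dWaveFormFactor L with hAdef
  set H : Matrix (Finset (Orb (FermionTorus 2 L))) (Finset (Orb (FermionTorus 2 L))) ℂ :=
    hubbardTorus 2 L 1 U with hHdef
  set S : Submodule ℂ (Fock (Orb (FermionTorus 2 L))) :=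
    szSector (Λ := FermionTorus 2 L) (2 * m) 0 with hSdef
  have hL : (0 : ℝ) < (L : ℝ) := by exact_mod_cast Nat.pos_of_ne_zero (NeZero.ne L)
  have hL4 : (0 : ℝ) < (L : ℝ) ^ 4 := by positivity
  have hHh : H.IsHermitian := LiebThm1.hamiltonian_isHermitian (fermionTorusGraph 2 L) 1 U
  have hAp : A.PosSemidef := Matrix.posSemidef_conjTranspose_mul_self _
  have hAh : A.IsHermitian := hAp.isHermitian
  have hSH : ∀ v ∈ S, H *ᵥ v ∈ S := fun v hv => hubbardTorus_mulVec_mem_szSector 2 L 1 U m hv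
  -- the norm ceiling `M`
  set C : ℝ := ∑ e ∈ insert 0 unitSteps, ‖((dWaveFormFactor e / Real.sqrt 2 : ℝ) : ℂ)‖ * 2 with hC
  set M : ℝ := (C * (L : ℝ) ^ 2) ^ 2 + 1 with hMdef
  have hM0 : 0 < M := by positivity
  have hM : ∀ v : Fock (Orb (FermionTorus 2 L)),
      (star v ⬝ᵥ (A *ᵥ v)).re ≤ M * (star v ⬝ᵥ v).re := by
    intro v
    have h := re_expect_pairField_conjTranspose_mul_le dWaveFormFactor L v
    have hv0 : 0 ≤ (star v ⬝ᵥ v).re :=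
      (Complex.nonneg_iff.mp (dotProduct_star_self_nonneg v)).1
    calc (star v ⬝ᵥ (A *ᵥ v)).re ≤ (C * (L : ℝ) ^ 2) ^ 2 * (star v ⬝ᵥ v).re := h
      _ ≤ M * (star v ⬝ᵥ v).re := by
          apply mul_le_mul_of_nonneg_right _ hv0
          rw [hMdef]
          linarith
  -- the every-ground-state floor, homogeneous on `E₀`
  set mfl : ℝ := a * (L : ℝ) ^ 4 with hmfl
  have hmfl0 : 0 < mfl := mul_pos ha hL4
  have hunit : ∀ ψ ∈ S ⊓ Module.End.eigenspace (Matrix.toLin' H) ((H.minEnergyOn S : ℝ) : ℂ),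
      star ψ ⬝ᵥ ψ = 1 → mfl ≤ (star ψ ⬝ᵥ (A *ᵥ ψ)).re :=
    fun ψ hψ h1 => hGS ψ (isGroundStateInSector_of_mem_inf_eigenspace H (2 * m) 0 hψ h1) h1
  have hmE : ∀ ψ ∈ S ⊓ Module.End.eigenspace (Matrix.toLin' H) ((H.minEnergyOn S : ℝ) : ℂ),
      mfl * (star ψ ⬝ᵥ ψ).re ≤ (star ψ ⬝ᵥ (A *ᵥ ψ)).re :=
    fun ψ hψ => mul_re_le_re_quadForm_of_unit_bound _ hunit ψ hψ
  -- the gap of `H` above the sector energy and the coupling `g`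
  obtain ⟨γ, hγ, hgap⟩ := exists_gap_above hHh.eigenvalues (H.minEnergyOn S)
  set g : ℝ := γ * mfl / (2 * M * (mfl + 2 * M)) with hgdef
  have hden : 0 < 2 * M * (mfl + 2 * M) := by positivity
  have hg0 : 0 < g := by rw [hgdef]; positivity
  have hgs : 2 * g * M * (mfl + 2 * M) ≤ γ * mfl := by
    have : 2 * g * M * (mfl + 2 * M) = γ * mfl := by
      rw [hgdef]
      field_simp
    rw [this]
  refine ⟨g, hg0, ?_⟩
  -- the penalised Hamiltonian and its sector ground eigenspace
  set X : Matrix (Finset (Orb (FermionTorus 2 L))) (Finset (Orb (FermionTorus 2 L))) ℂ :=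
    H + ((g : ℝ) : ℂ) • A with hXdef
  have hgA : (((g : ℝ) : ℂ) • A).IsHermitian := by
    unfold Matrix.IsHermitian
    rw [conjTranspose_smul, hAh.eq, Complex.star_def, Complex.conj_ofReal]
  have hXh : X.IsHermitian := hHh.add hgA
  set Eg : Submodule ℂ (Fock (Orb (FermionTorus 2 L))) :=
    S ⊓ Module.End.eigenspace (Matrix.toLin' X) (((X.minEnergyOn S : ℝ)) : ℂ) with hEgdef
  obtain ⟨k, b, hk, hbE, hb1, htr⟩ := exists_frame_trace_projMatrix_map_mul Eg
  -- each frame vector carries `≥ mfl / 4` of `A`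
  have hb : ∀ j, mfl / 4 ≤ (star (b j) ⬝ᵥ (A *ᵥ b j)).re := by
    intro j
    obtain ⟨hbS, hbeig⟩ := Submodule.mem_inf.mp (hbE j)
    rw [Module.End.mem_eigenspace_iff, Matrix.toLin'_apply] at hbeig
    -- the sector is inhabited, so `H` has a normalised sector ground state `ψ₀`
    have hS0 : S ≠ ⊥ := by
      intro hbot
      have hzero : b j = 0 := by
        have := hbS
        rwa [hbot, Submodule.mem_bot] at this
      have := hb1 j
      rw [hzero, dotProduct_zero] at this
      exact zero_ne_one this
    obtain ⟨ψ₀, hψ₀S, hψ₀1, hHψ₀⟩ := exists_unit_eigen_minEnergyOn hHh S hSH hS0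
    -- Rayleigh quotients of `X`
    have hexpand : ∀ v : Fock (Orb (FermionTorus 2 L)),
        (star v ⬝ᵥ (X *ᵥ v)).re =
          (star v ⬝ᵥ (H *ᵥ v)).re + g * (star v ⬝ᵥ (A *ᵥ v)).re := by
      intro v
      rw [hXdef, add_mulVec, dotProduct_add, smul_mulVec, dotProduct_smul, Complex.add_re,
        smul_eq_mul, Complex.re_ofReal_mul]
    have h1 : (star (b j) ⬝ᵥ (X *ᵥ b j)).re = X.minEnergyOn S := by
      rw [hbeig, dotProduct_smul, hb1 j, smul_eq_mul, mul_one, Complex.ofReal_re]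
    have h2 : X.minEnergyOn S ≤ (star ψ₀ ⬝ᵥ (X *ᵥ ψ₀)).re :=
      minEnergyOn_le_rayleigh_of_mem hXh S hψ₀S hψ₀1
    have h3 : (star ψ₀ ⬝ᵥ (H *ᵥ ψ₀)).re = H.minEnergyOn S := by
      rw [hHψ₀, dotProduct_smul, hψ₀1, smul_eq_mul, mul_one, Complex.ofReal_re]
    have h4 : (star ψ₀ ⬝ᵥ (A *ᵥ ψ₀)).re ≤ M := by
      have := hM ψ₀
      rwa [hψ₀1, Complex.one_re, mul_one] at this
    have hφE : (star (b j) ⬝ᵥ (H *ᵥ b j)).re + g * (star (b j) ⬝ᵥ (A *ᵥ b j)).re ≤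
        H.minEnergyOn S + g * M := by
      rw [← hexpand, h1]
      calc X.minEnergyOn S ≤ (star ψ₀ ⬝ᵥ (X *ᵥ ψ₀)).re := h2
        _ = H.minEnergyOn S + g * (star ψ₀ ⬝ᵥ (A *ᵥ ψ₀)).re := by rw [hexpand, h3]
        _ ≤ H.minEnergyOn S + g * M := by
            have := mul_le_mul_of_nonneg_left h4 hg0.le
            linarith
    exact re_quadForm_ge_of_penalisedGroundState hHh hAp S hSH hM hmfl0.le hmE hγ hgap hg0 hgs
      hbS (hb1 j) hφE
  -- sum over the frame
  have htrP : (projMatrix (Eg.map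
      ((WithLp.linearEquiv 2 ℂ (Finset (Orb (FermionTorus 2 L)) → ℂ)).symm :
        (Finset (Orb (FermionTorus 2 L)) → ℂ) →ₗ[ℂ]
          EuclideanSpace ℂ (Finset (Orb (FermionTorus 2 L)))))).trace.re = k := by
    rw [re_trace_projMatrix_map_eq_finrank, hk]
  show a / 4 * (L : ℝ) ^ 4 * (projMatrix (Eg.map
      ((WithLp.linearEquiv 2 ℂ (Finset (Orb (FermionTorus 2 L)) → ℂ)).symm :
        (Finset (Orb (FermionTorus 2 L)) → ℂ) →ₗ[ℂ]
          EuclideanSpace ℂ (Finset (Orb (FermionTorus 2 L)))))).trace.re ≤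
    (projMatrix (Eg.map
      ((WithLp.linearEquiv 2 ℂ (Finset (Orb (FermionTorus 2 L)) → ℂ)).symm :
        (Finset (Orb (FermionTorus 2 L)) → ℂ) →ₗ[ℂ]
          EuclideanSpace ℂ (Finset (Orb (FermionTorus 2 L))))) * A).trace.re
  have hquarter : a / 4 * (L : ℝ) ^ 4 = mfl / 4 := by rw [hmfl]; ring
  rw [hquarter, htrP, htr A, Complex.re_sum]
  calc mfl / 4 * (k : ℝ) = ∑ _j : Fin k, mfl / 4 := by
        rw [Finset.sum_const, Finset.card_univ, Fintype.card_fin, nsmul_eq_mul, mul_comm]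
    _ ≤ ∑ j : Fin k, (star (b j) ⬝ᵥ (A *ᵥ b j)).re := Finset.sum_le_sum fun j _ => hb j

/-- **Every-ground-state pair order ⇒ the SHIFTED ground-state average, in the format of the
conjugate-source closer.** At side `L ≥ 1`, coupling `U` and filling `δ`: if every normalised
`(2⌊(1-δ)L²/2⌋, S^z = 0)`-sector ground state of `hubbardTorus 2 L 1 U` has `a L⁴ ≤ re ⟨ψ, Δ_d†Δ_d ψ⟩`
(`a > 0`), then some `κ > 0` carries `(a/4) L⁴ · re tr P_κ ≤ re tr (P_κ Δ_d† Δ_d)` for the ground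
projector `P_κ` of the penalised Hamiltonian `H + κ L⁻⁴ Δ_d† Δ_d` in that sector — verbatim the
matrix consumed by `hubbardSuperconductivity_of_shiftedAverage` /
`forall_groundState_bound_of_shiftedAverage` (`κ = g L⁴` in
`exists_penalisedAverage_of_forall_groundState_bound`). Together with that closer: per side, the
shifted ground-state average and the every-ground-state floor are the SAME datum up to the
constant `4`. Griffiths (1964) §III; Tasaki (2020) §2.2. [folklore] -/
theorem exists_shiftedAverage_of_forall_groundState_bound (L : ℕ) [NeZero L] (U δ a : ℝ)
    (ha : 0 < a)
    (hGS : ∀ ψ : Fock (Orb (FermionTorus 2 L)),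
      IsGroundStateInSector (hubbardTorus 2 L 1 U) (2 * ⌊(1 - δ) * (L : ℝ) ^ 2 / 2⌋₊) 0 ψ →
      star ψ ⬝ᵥ ψ = 1 →
      a * (L : ℝ) ^ 4 ≤
        (star ψ ⬝ᵥ ((pairField dWaveFormFactor L)ᴴ * pairField dWaveFormFactor L) *ᵥ ψ).re) :
    ∃ κ : ℝ, 0 < κ ∧
      let N : ℕ := 2 * ⌊(1 - δ) * (L : ℝ) ^ 2 / 2⌋₊
      let H := hubbardTorus 2 L 1 U
      let S := szSector (Λ := FermionTorus 2 L) N 0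
      let Yd : Matrix (Finset (Orb (FermionTorus 2 L))) (Finset (Orb (FermionTorus 2 L))) ℂ :=
        ((1 : ℂ) / (L : ℂ) ^ 4) • ((pairField dWaveFormFactor L)ᴴ * pairField dWaveFormFactor L)
      let E := S ⊓ Module.End.eigenspace (Matrix.toLin' (H + (κ : ℂ) • Yd))
        ((((H + (κ : ℂ) • Yd).minEnergyOn S : ℝ)) : ℂ)
      let P := projMatrix (E.map (Fock.toEuclidean (ι := Orb (FermionTorus 2 L)) :
        Fock (Orb (FermionTorus 2 L)) →ₗ[ℂ] EuclideanSpace ℂ (Finset (Orb (FermionTorus 2 L)))))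
      a / 4 * (L : ℝ) ^ 4 * P.trace.re ≤
        (P * ((pairField dWaveFormFactor L)ᴴ * pairField dWaveFormFactor L)).trace.re := by
  obtain ⟨g, hg, hineq⟩ := exists_penalisedAverage_of_forall_groundState_bound L U a ha hGS
  have hL : (0 : ℝ) < (L : ℝ) := by exact_mod_cast Nat.pos_of_ne_zero (NeZero.ne L)
  refine ⟨g * (L : ℝ) ^ 4, mul_pos hg (by positivity), ?_⟩
  dsimp only
  have hmat : hubbardTorus 2 L 1 U + ((g * (L : ℝ) ^ 4 : ℝ) : ℂ) •
      (((1 : ℂ) / (L : ℂ) ^ 4) • ((pairField dWaveFormFactor L)ᴴ * pairField dWaveFormFactor L)) =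
      hubbardTorus 2 L 1 U + ((g : ℝ) : ℂ) • ((pairField dWaveFormFactor L)ᴴ * pairField dWaveFormFactor L) := by
    have hL0 : (L : ℂ) ≠ 0 := by exact_mod_cast NeZero.ne L
    rw [smul_smul]
    congr 2
    push_cast
    field_simp
  rw [hmat, map_toEuclidean_eq]
  exact hineq

/-! ## The re-cut: ONE descent crux, to the shifted ground-state average, closes the route -/

/-- **The route's deciding implication with cruxes #3 (`LogColdToGround`, stmt-8808) and #4
(`AverageToEvery`, stmt-10519) REPLACED by one descent crux to the SHIFTED ground-state average.**
The second hypothesis ("shifted descent") has the hypothesis of `LogColdToGround` verbatim (log-cold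
sector `d`-wave order on the window for every `κ ≥ κ₀`, eventually in even `L`) and concludes, at ONE
coupling `U` of the window, the matrix of `hubbardSuperconductivity_of_shiftedAverage`: eventually in
even `L`, for SOME `κ > 0` per side, the ground-state average of `Δ_d† Δ_d` over the sector ground
eigenspace of the PENALISED `hubbardTorus 2 L 1 U + κ L⁻⁴ Δ_d† Δ_d` is `≥ c' L⁴`. With
`LogColdDWaveOrder` (which supplies `δ ∈ (0, 1/2)`, the window and the thermal order) this gives
`HubbardSuperconductivity` by the landed conjugate-source closer — no genericity in `U`, no
every-ground-state item, and the window in `U` is merely threaded through (one coupling is used).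
Plan-level certificate for the planner (D-0014); by
`shiftedDescent_of_logColdToGround_of_averageToEvery` the merged crux is implied by the two it
replaces. Griffiths (1964) §III; Scalapino, Phys. Rep. 250 (1995) 329 §2. [folklore] -/
theorem hubbardSuperconductivity_of_logColdOrder_of_shiftedDescent :
    Summit.HubbardSuperconductivity.HubbardSuperconductivity.Theses.LogColdTorus.LogColdDWaveOrder →
    (∀ (δ U₁ U₂ κ₀ c : ℝ), 0 < U₁ → U₁ < U₂ → 0 < κ₀ → 0 < c →
      (∀ κ : ℝ, κ₀ ≤ κ → ∃ L₀ : ℕ, ∀ U ∈ Set.Ioo U₁ U₂, ∀ (L : ℕ) [NeZero L], L₀ ≤ L → Even L →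
        let p : Finset (Orb (FermionTorus 2 L)) → Prop := fun s =>
          s.card = 2 * ⌊(1 - δ) * (L : ℝ) ^ 2 / 2⌋₊ ∧
            2 * (s.filter fun i => (ofLex i).2 = 0).card = 2 * ⌊(1 - δ) * (L : ℝ) ^ 2 / 2⌋₊
        c * (L : ℝ) ^ 4 ≤ (Matrix.gibbsState (κ * Real.log L) ((hubbardTorus 2 L 1 U).toBlock p p)
          (((pairField dWaveFormFactor L)ᴴ * pairField dWaveFormFactor L).toBlock p p)).re) →
      ∃ U ∈ Set.Ioo U₁ U₂, ∃ c' : ℝ, 0 < c' ∧ ∃ L₁ : ℕ, ∀ (L : ℕ) [NeZero L], L₁ ≤ L → Even L →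
        ∃ κ : ℝ, 0 < κ ∧
        let N : ℕ := 2 * ⌊(1 - δ) * (L : ℝ) ^ 2 / 2⌋₊
        let H := hubbardTorus 2 L 1 U
        let S := szSector (Λ := FermionTorus 2 L) N 0
        let Yd : Matrix (Finset (Orb (FermionTorus 2 L))) (Finset (Orb (FermionTorus 2 L))) ℂ :=
          ((1 : ℂ) / (L : ℂ) ^ 4) • ((pairField dWaveFormFactor L)ᴴ * pairField dWaveFormFactor L)
        let E := S ⊓ Module.End.eigenspace (Matrix.toLin' (H + (κ : ℂ) • Yd))
          ((((H + (κ : ℂ) • Yd).minEnergyOn S : ℝ)) : ℂ)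
        let P := projMatrix (E.map (Fock.toEuclidean (ι := Orb (FermionTorus 2 L)) :
          Fock (Orb (FermionTorus 2 L)) →ₗ[ℂ] EuclideanSpace ℂ (Finset (Orb (FermionTorus 2 L)))))
        c' * (L : ℝ) ^ 4 * P.trace.re ≤
          (P * ((pairField dWaveFormFactor L)ᴴ * pairField dWaveFormFactor L)).trace.re) →
    HubbardSuperconductivity := by
  intro h1 hSD
  obtain ⟨δ, hδ, U₁, U₂, hU₁, hU₁₂, κ₀, c, hκ₀, hc, h⟩ := h1
  obtain ⟨U, hU, c', hc', L₁, hL₁⟩ := hSD δ U₁ U₂ κ₀ c hU₁ hU₁₂ hκ₀ hc h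
  exact hubbardSuperconductivity_of_shiftedAverage ⟨δ, hδ, U, lt_trans hU₁ hU.1, c', hc', L₁, hL₁⟩

/-- **The merged crux is implied by the two cruxes it replaces.** `LogColdToGround` (stmt-8808: window
log-cold order ⇒ window ground-state-average order, uniform threshold) and `AverageToEvery`
(stmt-10519: window ground-state-average order ⇒ every sector ground state ordered at one coupling of
the window) together give the shifted descent of
`hubbardSuperconductivity_of_logColdOrder_of_shiftedDescent`: descend, transfer to every ground state at
one coupling (`averageToEvery_iff_transfer`), and re-dress the every-ground-state floor as the
ground-state average of the penalised Hamiltonian at a small coupling per side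
(`exists_shiftedAverage_of_forall_groundState_bound`, constant `a/4`). So the re-cut replaces two open
cruxes by ONE that is no stronger than their conjunction and that closes the route by itself.
Griffiths (1964) §III; Tasaki (2020) §2.2. [folklore] -/
theorem shiftedDescent_of_logColdToGround_of_averageToEvery : Summit.HubbardSuperconductivity.HubbardSuperconductivity.Theses.LogColdTorus.LogColdToGround → Summit.HubbardSuperconductivity.HubbardSuperconductivity.Theses.LogColdTorus.AverageToEvery → (∀ (δ U₁ U₂ κ₀ c : ℝ), 0 < U₁ → U₁ < U₂ → 0 < κ₀ → 0 < c → (∀ κ : ℝ, κ₀ ≤ κ → ∃ L₀ : ℕ, ∀ U ∈ Set.Ioo U₁ U₂, ∀ (L : ℕ) [NeZero L], L₀ ≤ L → Even L → let p : Finset (Orb (FermionTorus 2 L)) → Prop := fun s => s.card = 2 * ⌊(1 - δ) * (L : ℝ) ^ 2 / 2⌋₊ ∧ 2 * (s.filter fun i => (ofLex i).2 = 0).card = 2 * ⌊(1 - δ) * (L : ℝ) ^ 2 / 2⌋₊; c * (L : ℝ) ^ 4 ≤ (Matrix.gibbsState (κ * Real.log L) ((hubbardTorus 2 L 1 U).toBlock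 p p) (((pairField dWaveFormFactor L)ᴴ * pairField dWaveFormFactor L).toBlock p p)).re) → ∃ U ∈ Set.Ioo U₁ U₂, ∃ c' : ℝ, 0 < c' ∧ ∃ L₁ : ℕ, ∀ (L : ℕ) [NeZero L], L₁ ≤ L → Even L → ∃ κ : ℝ, 0 < κ ∧ let N : ℕ := 2 * ⌊(1 - δ) * (L : ℝ) ^ 2 / 2⌋₊; let H := hubbardTorus 2 L 1 U; let S := szSector (Λ := FermionTorus 2 L) N 0; let Yd : Matrix (Finset (Orb (FermionTorus 2 L))) (Finset (Orb (FermionTorus 2 L))) ℂ := ((1 : ℂ) / (L : ℂ) ^ 4) • ((pairField dWaveFormFactor L)ᴴ * pairField dWaveFormFactor L); let E := S ⊓ Module.End.eigenspace (Matrix.toLin' (H + (κ : ℂ) • Yd)) ((((H + (κ : ℂ) • Yd).minEnergyOn S : ℝ)) : ℂ); let P := projMatrix (E.map (Fock.toEuclidean (ι := Orb (FermionTorus 2 L)) : Fock (Orb (FermionTorus 2 L)) →ₗ[ℂ] EuclideanSpace ℂ (Finset (Orb (FermionTorus 2 L))))); c' * (L : ℝ) ^ 4 * P.trace.re ≤ (P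 * ((pairField dWaveFormFactor L)ᴴ * pairField dWaveFormFactor L)).trace.re) := by
  intro h2 h3 δ U₁ U₂ κ₀ c hU₁ hU₁₂ hκ₀ hc htherm
  obtain ⟨c', hc', L₁, havg⟩ := h2 δ U₁ U₂ κ₀ c hU₁ hU₁₂ hκ₀ hc htherm
  obtain ⟨U, hU, a, ha, L₂, hGS⟩ := averageToEvery_iff_transfer.1 h3 δ U₁ U₂ c' L₁ hU₁ hU₁₂ hc'
    (fun U hU L _ hL hLe => havg U hU L hL hLe)
  refine ⟨U, hU, a / 4, by positivity, L₂, fun L _ hL hLe => ?_⟩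
  exact exists_shiftedAverage_of_forall_groundState_bound L U δ a ha (hGS L hL hLe)

end Summit.HubbardSuperconductivity.HubbardSuperconductivity.Theorems

end
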